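import Mathlib.Topology.Irreducible
import Mathlib.Topology.Clopen
import Literature.NumberTheory.GaloisRepresentations.IrredChamberAt
import Literature.AlgebraicGeometry.Resolution.NoetherianComponents
import HarnessLib

/-!
# `ChamberQpSplit` (item stmt-Langlands-14533, support of route `TriangulineChamber`) — the typed
# transfer principle "nonsplit companion ⇒ split residual representation"

The route's informal support `ChamberQpSplit` is the TRANSFER LEMMA at `K = ℚ_p`: for a split
generic `ρ̄ = χ̄₁ ⊕ χ̄₂ : 𝒢_{ℚ_p} → GL₂(k)` the chamber statement `IRR''(ρ̄, t)` ("at most one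
seeded non-ordinary irreducible component of the trianguline variety `X_tri^□(ρ̄)` over the torsion
type `t`") follows from the corresponding statement for a NONSPLIT companion
`r̄' ∈ Ext¹(χ̄₂, χ̄₁) ∖ 0` (in print for very generic `r̄'`: Liu–Truong–Xiao–Zhao, arXiv:2302.07697,
§9 Cor. "irreducible components" with `m = 1` and Thm. "`X_tri = X`").  The item has no Lean
signature (the genuine rigid spaces are not in the tree); this file proves its TYPED CORE over the
accepted interface `TriangulineVariety` / `IrredChamberAt`, hypothesis-relatively, and isolates
exactly the geometric input the transfer consumes.

## The mechanism ("Ribet's lattice segment, globally")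

Both framed deformation spaces map to ONE base over their irreducible loci: with `R^ps` the
(formally smooth, 5-dimensional) pseudodeformation ring of `χ̄₁ + χ̄₂` and `y ∈ R^ps` its
reducibility parameter, `R^□_ρ̄ ≅ R^ps⟦b₀, c₀, u, v⟧/(b₀c₀ - y)` (generalised matrix algebra
structure of the Cayley–Hamilton quotient, Bellaïche–Chenevier) while `R^□_{r̄'} ≅ R^ps⟦w, u, v⟧`;
so over `{y ≠ 0}` the rigid fibre `𝔛^□_ρ̄` is a relative OPEN ANNULUS `{|y| < |b₀| < 1}` times a
bidisc over `𝔛^ps`, and `𝔛^□_{r̄'}` a tridisc bundle: both projections are Zariski-open, surjective,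
with irreducible fibres, and the universal Galois representations are fibrewise constant up to
isomorphism.  Being trianguline of parameter `δ` depends only on `(V, δ)`, so the two framed
trianguline varieties over `{y ≠ 0}` are the pull-backs of one pseudo-trianguline variety `S`, and
a continuous open surjection with irreducible fibres induces a bijection of irreducible components
(Mathlib `irreducibleComponentsEquivOfIsPreirreducibleFiber`, Stacks 037A).  The full argument that
the genuine spaces furnish such CHARTS is the evidence note `ChamberQpSplit-proof.md` attached to
the item; here the charts are hypotheses.

## What this file proves (sorry-free, no new definitions)

* `subsingleton_components_of_charts` — point-set topology: two spaces `A`, `B` with open parts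
  `W_A`, `W_B` charted onto a common `S` by continuous open surjections with preirreducible fibres;
  if at most one irreducible component of `B` inside a clopen `T_B` meets `W_B`, then at most one
  irreducible component of `A` inside `T_A` meets `W_A` (types compatible along the charts).
* `subsingleton_typeComponents_of_companionCharts` — the same for two trianguline-variety data
  `X` (for `ρ̄`) and `Y` (for `r̄'`) and a torsion type `t` (type strata are clopen; the torsion type
  is read on the common base).
* `irredChamberAt_of_companionCharts` — **the transfer**: if moreover every irreducible component of
  `X.Pt` missing the charted locus `W_X` lies in the Borel-valued closure `Z_B` (for the genuine
  space: components inside the reducible locus `{y = 0}` are ordinary, a dimension count), then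
  "at most one component of `Y` of type `t` meets `W_Y`" implies `X.IrredChamberAt d 𝔇 t`.
* `irredChamberAt_of_companionCharts_of_disjoint` — the variant whose `Y`-side input is phrased as
  the route's nonsplit statement "at most one component of type `t` NOT contained in `Z_B(Y)`"
  (positive-slope part irreducible), given that `W_Y` misses `Z_B(Y)` (Borel-valued lifts are
  reducible).

Design note: the seed of a chamber is NOT transported (a reducible seed of `X_tri^□(ρ̄)` — the
non-critical anti-tautological refinement of a nonsplit crystalline extension — need not have a
companion framing reducing to the chosen `r̄'`); the transfer therefore consumes the seed-free
nonsplit statement, which is what LTXZ prove.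

References: Liu–Truong–Xiao–Zhao, arXiv:2302.07697, §7.3, Rem. 122(2), §9; Breuil–Hellmann–Schraen,
arXiv:1411.7260, §2.2; Bellaïche–Chenevier, Astérisque 324, Thm. 1.4.4; B. Conrad, Ann. Inst.
Fourier 49 (1999) §2.2; Stacks 037A / 004Z.
-/

set_option linter.dupNamespace false -- project-wide option (lakefile weak.linter.dupNamespace); `Summit.Langlands.Langlands` is the mandated namespace

namespace Summit.Langlands.Langlands.Theorems.ChamberQpSplit

open Set Topology TopologicalSpace
open Literature.NumberTheory.GaloisRepresentations

/-! ### Point-set topology: components through charts with irreducible fibres -/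

section Charts

variable {A B S : Type*} [TopologicalSpace A] [TopologicalSpace B] [TopologicalSpace S]

/-- For a continuous open map `π` with preirreducible fibres and an irreducible component `D` of
the source, `π ⁻¹' (π '' D) = D`: the preimage of the irreducible set `π '' D` is irreducible
(Stacks 004Z) and contains the maximal `D`. [folklore] -/
theorem preimage_image_eq_of_mem_irreducibleComponents {W : Type*} [TopologicalSpace W]
    {π : W → S} (hc : Continuous π) (ho : IsOpenMap π) (hf : ∀ s, IsPreirreducible (π ⁻¹' {s}))
    {D : Set W} (hD : D ∈ irreducibleComponents W) : π ⁻¹' (π '' D) = D := by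
  refine (hD.2 ?_ (subset_preimage_image π D)).antisymm (subset_preimage_image π D)
  refine ⟨?_, (hD.1.image π hc.continuousOn).2.preimage_of_isPreirreducible_fiber π ho hf⟩
  obtain ⟨x, hx⟩ := hD.1.nonempty
  exact ⟨x, x, hx, rfl⟩

/-- An irreducible component meeting an open set is the closure of its trace on it. [folklore] -/
theorem eq_closure_inter_of_mem_irreducibleComponents {C W : Set A}
    (hC : C ∈ irreducibleComponents A) (hW : IsOpen W) (hne : (C ∩ W).Nonempty) :
    C = closure (C ∩ W) :=
  (subset_closure_inter_of_isPreirreducible_of_isOpen hC.1.2 hW hne).antisymm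
    ((closure_mono inter_subset_left).trans
      (isClosed_of_mem_irreducibleComponents C hC).closure_eq.le)

/-- **Components through charts.**  Let `W_A ⊆ A`, `W_B ⊆ B` be open, charted onto a common space
`S` by continuous open surjections `π_A`, `π_B` with preirreducible fibres, and let `T_A ⊆ A`,
`T_B ⊆ B` with `T_B` clopen be compatible "types" (a point of `W_A` lying in `T_A` and a point of
`W_B` over the same point of `S` force the latter into `T_B`).  If at most one irreducible component
of `B` contained in `T_B` meets `W_B`, then at most one irreducible component of `A` contained in
`T_A` meets `W_A`.  Proof: a component `C` of `A` meeting `W_A` has as trace an irreducible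
component of `W_A` (open embedding), which is `π_A⁻¹ Z` for the component `Z = π_A(C ∩ W_A)` of `S`
(Stacks 037A); `π_B⁻¹ Z` is a component of `W_B`, the trace of a component `C'` of `B` meeting
`W_B`, of type `T_B`; and `C ↦ C'` is injective because `C = closure (C ∩ W_A)` and `π_B` is onto.
[folklore] -/
theorem subsingleton_components_of_charts {WA : Set A} {WB : Set B} (hWA : IsOpen WA)
    (hWB : IsOpen WB) {πA : WA → S} {πB : WB → S}
    (hAc : Continuous πA) (hAo : IsOpenMap πA) (hAf : ∀ s, IsPreirreducible (πA ⁻¹' {s}))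
    (hAs : Function.Surjective πA)
    (hBc : Continuous πB) (hBo : IsOpenMap πB) (hBf : ∀ s, IsPreirreducible (πB ⁻¹' {s}))
    (hBs : Function.Surjective πB) {TA : Set A} {TB : Set B} (hTB : IsClopen TB)
    (hT : ∀ (a : WA) (b : WB), πA a = πB b → (a : A) ∈ TA → (b : B) ∈ TB)
    (hB : {C' ∈ irreducibleComponents B | C' ⊆ TB ∧ (C' ∩ WB).Nonempty}.Subsingleton) :
    {C ∈ irreducibleComponents A | C ⊆ TA ∧ (C ∩ WA).Nonempty}.Subsingleton := by
  have heA : IsOpenEmbedding ((↑) : WA → A) := hWA.isOpenEmbedding_subtypeVal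
  have heB : IsOpenEmbedding ((↑) : WB → B) := hWB.isOpenEmbedding_subtypeVal
  -- Step 1: to each admissible component `C` of `A` attach a component `C'` of `B`, admissible,
  -- whose trace on `W_B` is `πB ⁻¹' (πA '' (C ∩ W_A))`.
  have key : ∀ C ∈ {C ∈ irreducibleComponents A | C ⊆ TA ∧ (C ∩ WA).Nonempty},
      ∃ C' ∈ {C' ∈ irreducibleComponents B | C' ⊆ TB ∧ (C' ∩ WB).Nonempty},
        ((↑) : WB → B) ⁻¹' C' = πB ⁻¹' (πA '' (((↑) : WA → A) ⁻¹' C)) := by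
    rintro C ⟨hC, hCT, hCW⟩
    -- the trace `D = C ∩ W_A` is an irreducible component of `W_A`
    have hD : ((↑) : WA → A) ⁻¹' C ∈ irreducibleComponents WA :=
      preimage_mem_irreducibleComponents hC heA (by rwa [Subtype.range_coe])
    -- its image `Z` is an irreducible component of `S` (Stacks 037A)
    have hZ : πA '' (((↑) : WA → A) ⁻¹' C) ∈ irreducibleComponents S :=
      image_mem_irreducibleComponents_of_isPreirreducible_fiber πA hAc hAo hAf hAs hD
    -- `E = πB ⁻¹' Z` is an irreducible component of `W_B`
    have hE : πB ⁻¹' (πA '' (((↑) : WA → A) ⁻¹' C)) ∈ irreducibleComponents WB :=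
      preimage_mem_irreducibleComponents_of_isPreirreducible_fiber hZ hBc hBo hBf
        (by rw [hBs.range_eq, inter_univ]; exact hZ.1.nonempty)
    -- `E` is the trace of an irreducible component `C'` of `B`
    obtain ⟨C', hC', -, hC'E⟩ :=
      Literature.AlgebraicGeometry.Resolution.exists_preimage_eq_of_mem_irreducibleComponents heB hE
    -- a point of `C ∩ W_A`, its image in `S`, and a point of `W_B` above it
    obtain ⟨a₀, ha₀C, ha₀W⟩ := hCW
    obtain ⟨b, hb⟩ := hBs (πA ⟨a₀, ha₀W⟩)
    have hbE : b ∈ πB ⁻¹' (πA '' (((↑) : WA → A) ⁻¹' C)) :=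
      ⟨⟨a₀, ha₀W⟩, ha₀C, hb.symm⟩
    have hbC' : (b : B) ∈ C' := by
      have : b ∈ ((↑) : WB → B) ⁻¹' C' := by rw [hC'E]; exact hbE
      exact this
    have hbT : (b : B) ∈ TB := hT ⟨a₀, ha₀W⟩ b hb.symm (hCT ha₀C)
    refine ⟨C', ⟨hC', ?_, ⟨b, hbC', b.2⟩⟩, hC'E⟩
    -- `C'` is preconnected and meets the clopen `T_B`, hence lies in it
    exact hC'.1.isPreirreducible.isPreconnected.subset_isClopen hTB ⟨b, hbC', hbT⟩
  -- Step 2: injectivity of `C ↦ C'`.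
  intro C₁ h₁ C₂ h₂
  obtain ⟨C'₁, h'₁, e₁⟩ := key C₁ h₁
  obtain ⟨C'₂, h'₂, e₂⟩ := key C₂ h₂
  have hCC : C'₁ = C'₂ := hB h'₁ h'₂
  -- equal traces on `W_B`, hence equal components of `S`, hence equal traces on `W_A`
  have hZZ : πA '' (((↑) : WA → A) ⁻¹' C₁) = πA '' (((↑) : WA → A) ⁻¹' C₂) :=
    hBs.preimage_injective (by rw [← e₁, ← e₂, hCC])
  have hDD : ((↑) : WA → A) ⁻¹' C₁ = ((↑) : WA → A) ⁻¹' C₂ := by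
    have hD₁ : ((↑) : WA → A) ⁻¹' C₁ ∈ irreducibleComponents WA :=
      preimage_mem_irreducibleComponents h₁.1 heA (by rw [Subtype.range_coe]; exact h₁.2.2)
    have hD₂ : ((↑) : WA → A) ⁻¹' C₂ ∈ irreducibleComponents WA :=
      preimage_mem_irreducibleComponents h₂.1 heA (by rw [Subtype.range_coe]; exact h₂.2.2)
    rw [← preimage_image_eq_of_mem_irreducibleComponents hAc hAo hAf hD₁,
      ← preimage_image_eq_of_mem_irreducibleComponents hAc hAo hAf hD₂, hZZ]
  -- `C_i = closure (C_i ∩ W_A)` and the traces agree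
  have htr : C₁ ∩ WA = C₂ ∩ WA := by
    have h := congrArg (fun D : Set WA => ((↑) : WA → A) '' D) hDD
    simpa only [image_preimage_eq_inter_range, Subtype.range_coe] using h
  rw [eq_closure_inter_of_mem_irreducibleComponents h₁.1 hWA h₁.2.2,
    eq_closure_inter_of_mem_irreducibleComponents h₂.1 hWA h₂.2.2, htr]

end Charts

/-! ### Trianguline-variety data: the transfer of `IrredChamberAt` along companion charts -/

section Transfer

variable {K : Type} [Field K] [ValuativeRel K] [TopologicalSpace K] [IsNonarchimedeanLocalField K]
  {p : ℕ} [Fact p.Prime] {O : Type} [CommRing O] [Algebra O (PadicAlgCl p)] {k : Type} [Field k]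
  [Algebra O k] [TopologicalSpace k] {n : ℕ} {ρbar ρbar' : ModPGaloisRep K k n}
  (X : TriangulineVariety K p O k ρbar) (Y : TriangulineVariety K p O k ρbar')
  {S : Type*} [TopologicalSpace S] {WX : Set X.Pt} {WY : Set Y.Pt}
  {πX : WX → S} {πY : WY → S}

/-- **Components of a given type through companion charts.**  Two trianguline-variety data `X`
(for `ρ̄`) and `Y` (for a companion `r̄'`), open loci `W_X`, `W_Y` (intended: the points whose Galois
representation is absolutely irreducible) charted onto a common space `S` (intended: the
pseudo-trianguline variety over the irreducible locus of the pseudodeformation space) by continuous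
open surjections with preirreducible fibres, such that points over the same point of `S` have the
same torsion type (intended: the same parameter `δ`).  If at most one irreducible component of `Y`
of type `t` meets `W_Y`, then at most one irreducible component of `X` of type `t` meets `W_X`.
[folklore] -/
theorem subsingleton_typeComponents_of_companionCharts (hWX : IsOpen WX) (hWY : IsOpen WY)
    (hXc : Continuous πX) (hXo : IsOpenMap πX) (hXf : ∀ s, IsPreirreducible (πX ⁻¹' {s}))
    (hXs : Function.Surjective πX)
    (hYc : Continuous πY) (hYo : IsOpenMap πY) (hYf : ∀ s, IsPreirreducible (πY ⁻¹' {s}))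
    (hYs : Function.Surjective πY)
    (hpar : ∀ (x : WX) (y : WY), πX x = πY y → X.torsionType x = Y.torsionType y)
    (t : Fin n → (CommGroup.torsion Kˣ →* (PadicAlgCl p)ˣ))
    (hY : {C' ∈ irreducibleComponents Y.Pt | C' ⊆ Y.typeStratum t ∧ (C' ∩ WY).Nonempty}.Subsingleton) :
    {C ∈ irreducibleComponents X.Pt | C ⊆ X.typeStratum t ∧ (C ∩ WX).Nonempty}.Subsingleton :=
  subsingleton_components_of_charts hWX hWY hXc hXo hXf hXs hYc hYo hYf hYs
    (Y.isClopen_typeStratum t)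
    (fun x y hxy hx => by
      rw [TriangulineVariety.mem_typeStratum_iff] at hx ⊢
      rw [← hpar x y hxy, hx])
    hY

/-- **The transfer `ChamberQpSplit` (typed core).**  In the situation of
`subsingleton_typeComponents_of_companionCharts`, assume moreover that every irreducible component
of `X.Pt` disjoint from the charted locus `W_X` is contained in the Borel-valued closure
`Z_B = closure {x | X.IsBorelValuedAt d x}` (for the genuine `X_tri^□(ρ̄)`, `ρ̄` split generic over
`ℚ_p`: an irreducible component inside the reducible locus `{y = 0}` is ordinary — the reducible
points with a non-tautological parameter form a locus of dimension `≤ 5 < 7`).  Then "at most one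
irreducible component of `Y` of type `t` meets `W_Y`" (for the genuine nonsplit companion: the
positive-slope part of `X_tri^□(r̄')` over `t` is irreducible, Liu–Truong–Xiao–Zhao §9) implies
`IRR''(ρ̄, t)` in the form `X.IrredChamberAt d 𝔇 t`: a seeded component not contained in `Z_B`
meets `W_X`, and there is at most one such component of type `t`. [folklore] -/
theorem irredChamberAt_of_companionCharts (hWX : IsOpen WX) (hWY : IsOpen WY)
    (hXc : Continuous πX) (hXo : IsOpenMap πX) (hXf : ∀ s, IsPreirreducible (πX ⁻¹' {s}))
    (hXs : Function.Surjective πX)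
    (hYc : Continuous πY) (hYo : IsOpenMap πY) (hYf : ∀ s, IsPreirreducible (πY ⁻¹' {s}))
    (hYs : Function.Surjective πY)
    (hpar : ∀ (x : WX) (y : WY), πX x = πY y → X.torsionType x = Y.torsionType y)
    (d : LocalArtinData K) (𝔇 : PstWeilDeligneData K p)
    (hord : ∀ C ∈ irreducibleComponents X.Pt, Disjoint C WX →
      C ⊆ closure {x | X.IsBorelValuedAt d x})
    (t : Fin n → (CommGroup.torsion Kˣ →* (PadicAlgCl p)ˣ))
    (hY : {C' ∈ irreducibleComponents Y.Pt | C' ⊆ Y.typeStratum t ∧ (C' ∩ WY).Nonempty}.Subsingleton) :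
    X.IrredChamberAt d 𝔇 t := by
  refine (subsingleton_typeComponents_of_companionCharts X Y hWX hWY hXc hXo hXf hXs hYc hYo hYf
    hYs hpar t hY).anti ?_
  rintro C ⟨hC, hCt, hCB, -⟩
  refine ⟨hC, hCt, ?_⟩
  by_contra hne
  exact hCB (hord C hC (disjoint_iff_inter_eq_empty.mpr (not_nonempty_iff_eq_empty.mp hne)))

/-- **Variant with the nonsplit input in the route's vocabulary.**  If the charted locus `W_Y` misses
the Borel-valued closure of `Y` (Borel-valued lifts are reducible, and `W_Y` is the open irreducible
locus), then "at most one irreducible component of `Y` of type `t` NOT contained in `Z_B(Y)`" — the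
seed-free form of `IRR''(r̄', t)`, i.e. the route's `ChamberQpNonsplit` "the positive-slope part of
`X_tri^□(r̄')` over `t` is irreducible" — implies `X.IrredChamberAt d 𝔇 t`. [folklore] -/
theorem irredChamberAt_of_companionCharts_of_disjoint (hWX : IsOpen WX) (hWY : IsOpen WY)
    (hXc : Continuous πX) (hXo : IsOpenMap πX) (hXf : ∀ s, IsPreirreducible (πX ⁻¹' {s}))
    (hXs : Function.Surjective πX)
    (hYc : Continuous πY) (hYo : IsOpenMap πY) (hYf : ∀ s, IsPreirreducible (πY ⁻¹' {s}))
    (hYs : Function.Surjective πY)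
    (hpar : ∀ (x : WX) (y : WY), πX x = πY y → X.torsionType x = Y.torsionType y)
    (d : LocalArtinData K) (𝔇 : PstWeilDeligneData K p)
    (hord : ∀ C ∈ irreducibleComponents X.Pt, Disjoint C WX →
      C ⊆ closure {x | X.IsBorelValuedAt d x})
    (hWYB : Disjoint WY (closure {y | Y.IsBorelValuedAt d y}))
    (t : Fin n → (CommGroup.torsion Kˣ →* (PadicAlgCl p)ˣ))
    (hY : {C' ∈ irreducibleComponents Y.Pt | C' ⊆ Y.typeStratum t ∧
      ¬ C' ⊆ closure {y | Y.IsBorelValuedAt d y}}.Subsingleton) :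
    X.IrredChamberAt d 𝔇 t := by
  refine irredChamberAt_of_companionCharts X Y hWX hWY hXc hXo hXf hXs hYc hYo hYf hYs hpar d 𝔇
    hord t (hY.anti ?_)
  rintro C' ⟨hC', hC't, y, hyC', hyW⟩
  exact ⟨hC', hC't, fun hsub => Set.disjoint_left.mp hWYB hyW (hsub hyC')⟩

end Transfer

/-! ### The closed form (candidate signature for the item) -/

/-- **`ChamberQpSplit`, closed hypothesis-relative form** (the candidate Lean signature of item
stmt-Langlands-14533, universally quantified over the data; proved outright).  For trianguline-variety
data `X` (for `ρ̄`) and `Y` (for a companion `r̄'`), open loci `W_X ⊆ X.Pt`, `W_Y ⊆ Y.Pt` charted onto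
a common space `S` by continuous open surjections with preirreducible fibres along which the
parameter `δ` is constant (the pseudo-deformation charts of the irreducible loci — for `K = ℚ_p`,
`ρ̄ = χ̄₁ ⊕ χ̄₂` generic and `r̄'` a nonsplit companion these exist by
`R^ver_ρ̄ ≅ R^ps⟦x, y⟧/(xy - c)`, `R^ps ≅ R_{r̄'}`, Paškūnas, Math. Z. 286 (2017) §5), such that the
irreducible components of `X.Pt` missing `W_X` are ordinary (`⊆ Z_B(X)`) and `W_Y` misses `Z_B(Y)`:
if `Y` has at most one irreducible component of type `t` not contained in `Z_B(Y)` (the nonsplit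
chamber statement, Liu–Truong–Xiao–Zhao §9 for very generic `r̄'` over `ℚ_p`), then
`X.IrredChamberAt d 𝔇 t` — `IRR''(ρ̄, t)`. [folklore] -/
theorem chamberQpSplit :
    ∀ {K : Type} [Field K] [ValuativeRel K] [TopologicalSpace K] [IsNonarchimedeanLocalField K]
      {p : ℕ} [Fact p.Prime] {O : Type} [CommRing O] [Algebra O (PadicAlgCl p)] {k : Type} [Field k]
      [Algebra O k] [TopologicalSpace k] {n : ℕ} {ρbar ρbar' : ModPGaloisRep K k n}
      (X : TriangulineVariety K p O k ρbar) (Y : TriangulineVariety K p O k ρbar')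
      (S : Type) [TopologicalSpace S] (WX : Set X.Pt) (WY : Set Y.Pt) (πX : WX → S) (πY : WY → S)
      (d : LocalArtinData K) (𝔇 : PstWeilDeligneData K p),
      IsOpen WX → IsOpen WY →
      Continuous πX → IsOpenMap πX → (∀ s, IsPreirreducible (πX ⁻¹' {s})) →
      Function.Surjective πX →
      Continuous πY → IsOpenMap πY → (∀ s, IsPreirreducible (πY ⁻¹' {s})) →
      Function.Surjective πY →
      (∀ (x : WX) (y : WY), πX x = πY y → X.param x = Y.param y) →
      (∀ C ∈ irreducibleComponents X.Pt, Disjoint C WX →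
        C ⊆ closure {x | X.IsBorelValuedAt d x}) →
      Disjoint WY (closure {y | Y.IsBorelValuedAt d y}) →
      ∀ t : Fin n → (CommGroup.torsion Kˣ →* (PadicAlgCl p)ˣ),
        {C' ∈ irreducibleComponents Y.Pt | C' ⊆ Y.typeStratum t ∧
          ¬ C' ⊆ closure {y | Y.IsBorelValuedAt d y}}.Subsingleton →
        X.IrredChamberAt d 𝔇 t := by
  intro K _ _ _ _ p _ O _ _ k _ _ _ n ρbar ρbar' X Y S _ WX WY πX πY d 𝔇 hWX hWY hXc hXo hXf hXs
    hYc hYo hYf hYs hpar hord hWYB t hY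
  refine irredChamberAt_of_companionCharts_of_disjoint X Y hWX hWY hXc hXo hXf hXs hYc hYo hYf hYs
    (fun x y hxy => ?_) d 𝔇 hord hWYB t hY
  -- equal parameters have equal torsion types
  funext i
  ext ζ
  simp only [TriangulineVariety.torsionType_apply, hpar x y hxy]

end Summit.Langlands.Langlands.Theorems.ChamberQpSplit
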